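import Summits.NavierStokesRegularity.NavierStokesRegularity.Theses.ConeTipCollapse
import Literature.Analysis.FluidPDE.LogPeriodicEulerCone
import HarnessLib.Audit

/-!
# Birth skeleton (BC3) of the crux `ConeTipCollapse.CollapsingResolver`

Crux item `stmt-NavierStokesRegularity-19061` (decl
`Summit.NavierStokesRegularity.NavierStokesRegularity.Theses.ConeTipCollapse.CollapsingResolver`, crux rank 2 = the
deciding ∃-package of the REFUTATION route `route-NavierStokesRegularity-ConeTipCollapse`, reached in its `closes` as
`ConeToResolver` applied to `InteractingLogPeriodicCone`; re-audit bin HONEST). Tree path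
`Cruxes/CollapsingResolver/Lines/birth.lean`; registrar `planner-skel-stmt-NavierStokesRegularity-19061-0`, 2026-08-17,
mode `skeleton-register` (one-shot: no new routes, no proving beyond the composition). It re-types, as a tree workfile,
the route's OWN declared layer-1 cut of the crux (route header TWO-LAYER PLAN: "CollapsingResolver ⇐ stub_cone
(= InteractingLogPeriodicCone) → stub_desing (ResolveOnly) → stub_corrector (CorrectOnly)"), with the same three stub
names the type-sketch seat `planner-type-9c17c6396d-0` registered at birth (its skeleton lived only in its session folder
and as item evidence; this file is the published, elaborating version). Nothing here is new mathematics.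

THE CRUX, READ AS THREE PREDICATES (verbatim regrouping of its 23 conjuncts, certified below by
`collapsingResolver_iff` / `interactingLogPeriodicCone_iff`, both sorry-free):
* `IsAdmissibleCone a l₀ h P`  (conjuncts 1–11): exponents `1 < a < 3/2`, ratio `l₀ > 1`, `(h,P)` is `C¹` off `0`,
  `l₀`-discretely self-similar of degrees `(−a, −2a)`, divergence-free and steady Euler off `0`, chiral-octahedrally
  (O-)equivariant, interacting (`h` vanishes identically on no nonempty open set);
* `IsResolution a h Q Φ`     (conjuncts 12–18): `(Q,Φ)` is a `C^∞` steady Euler flow on `ℝ³`, O-equivariant, nonzero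
  somewhere in every nonempty open set, with conical tail `‖Q y − h y‖ + ‖y‖‖DQ y − Dh y‖ ≤ C‖y‖^(−a−δ)` (`‖y‖ ≥ 1`);
* `IsCollapseCorrector a Q b W q` (conjuncts 19–23): `b < 0`, `W, q` smooth, `div W = 0`, and the first-order
  collapse-corrector equation `(Q·∇)W + (W·∇)Q + ∇q = ΔQ + b(aQ + (y·∇)Q)` on `ℝ³`.

`isAdmissibleCone_iff` bridges conjuncts 4–9 to the landed Literature definition
`Literature.Analysis.FluidPDE.IsLogPeriodicSteadyEulerCone` (the route's definition request; API `.conj`, `.zpow`).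

THE CUT (three named stubs; the seam is logical — existence ∘ desingularisation ∘ correction):
* `stub_cone : ConeTipCollapse.InteractingLogPeriodicCone` — twin BY NAME of route item `stmt-NavierStokesRegularity-19062`
  (crux rank 3, "the wall"): some admissible cone exists. Definitionally `∃ a l₀ h P, IsAdmissibleCone a l₀ h P`.
* `stub_desing : ResolveOnly` — EVERY admissible cone is the tangent flow at infinity of some resolution `(Q,Φ)`
  (equivariant desingularisation of the cone tip; engine named by the route: Voigt–MHD magnetic relaxation from the
  truncated cone, arXiv:2208.11109). ∀-form STUB, never an item (a refuted ∀-stub kills this line, not the route).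
* `stub_corrector : CorrectOnly` — EVERY resolved skeleton `(a,l₀,h,P,Q,Φ)` admits a collapse corrector with `b < 0`
  (solvability of (★★): per-torus energy/flux laws on the compact Bernoulli tori of `Q`, Arnold structure + hyperbolic
  axis chains). ∀-form STUB, never an item.

`CollapsingResolver_of : ConeTipCollapse.CollapsingResolver` is the ONLY theorem of this file concluding the crux (A12
layer invariant: conclusion = the crux BY NAME, no `Prop` hypotheses, placeholders only inside the three declared stubs,
which it uses by name). The hypotheses forms live in the registrar's closed evidence file
`bc/CollapsingResolver_birth_closed.lean` (0 sorry, axioms ⊆ {propext, Classical.choice, Quot.sound}):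
`CollapsingResolver_of_hyps : InteractingLogPeriodicCone → ResolveOnly → CorrectOnly → CollapsingResolver` (this
composition with the stubs abstracted) and `coneToResolver_of_hyps : ResolveOnly → CorrectOnly →
ConeTipCollapse.ConeToResolver` (stubs 2–3 alone give the route's crux #4, item 19063, by name — the route header's
"ConeToResolver ⇐ stub_desing → stub_corrector").

Disproof used: none exists for this crux (`ledger crux ls stmt-NavierStokesRegularity-19061`: no workfiles before this
one). Negatives consulted (`ledger negatives --problem NavierStokesRegularity`): the nearest refuted statement is
`AdiabaticEddy.CorrectorSolvable` (stmt-NavierStokesRegularity-1429: corrector about a COMPACTLY SUPPORTED eddy, killed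
by compact support × diffusion / unique continuation); `CorrectOnly` is not an instance — its `Q` is nonzero on every
nonempty open set (conjunct 17) and has an interacting conical tail, so the UCP/flatness witness has nothing to start
from (this is the successor object (2b) named by that kill memo, as the route header states). No stub is an instance of
a refuted statement; `stub_cone` is the OPEN item 19062 of the same route.
-/

namespace Summit.NavierStokesRegularity.NavierStokesRegularity.Cruxes.CollapsingResolver.Birth

set_option linter.dupNamespace false
set_option linter.unusedVariables false

open Summit.NavierStokesRegularity.NavierStokesRegularity.Theses.ConeTipCollapse

/-- Conjuncts 1–11 of the crux: `(a, l₀, h, P)` is an ADMISSIBLE CONE — an interacting, chiral-octahedrally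
equivariant, `l₀`-discretely self-similar (degrees `−a`, `−2a`), `C¹` steady Euler flow on `ℝ³ ∖ 0` with
`1 < a < 3/2`. Verbatim the body of `ConeTipCollapse.InteractingLogPeriodicCone` under its four binders. -/
def IsAdmissibleCone (a l₀ : ℝ) (h : EuclideanSpace ℝ (Fin 3) → EuclideanSpace ℝ (Fin 3))
    (P : EuclideanSpace ℝ (Fin 3) → ℝ) : Prop :=
  1 < a ∧ a < 3 / 2 ∧ 1 < l₀ ∧ ContDiffOn ℝ 1 h {x : EuclideanSpace ℝ (Fin 3) | x ≠ 0} ∧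
  ContDiffOn ℝ 1 P {x : EuclideanSpace ℝ (Fin 3) | x ≠ 0} ∧
  (∀ x : EuclideanSpace ℝ (Fin 3), x ≠ 0 → h (l₀ • x) = (l₀ ^ (-a)) • h x) ∧
  (∀ x : EuclideanSpace ℝ (Fin 3), x ≠ 0 → P (l₀ • x) = l₀ ^ (-(2 * a)) * P x) ∧
  (∀ x : EuclideanSpace ℝ (Fin 3), x ≠ 0 → Literature.Analysis.FluidPDE.VectorCalculus.divergence h x = 0) ∧
  (∀ x : EuclideanSpace ℝ (Fin 3), x ≠ 0 → Literature.Analysis.FluidPDE.convect h h x + gradient P x = 0) ∧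
  (∀ g : EuclideanSpace ℝ (Fin 3) ≃ₗᵢ[ℝ] EuclideanSpace ℝ (Fin 3), Literature.Analysis.FluidPDE.IsOctahedralIsometry g →
    LinearMap.det (g.toLinearEquiv : EuclideanSpace ℝ (Fin 3) →ₗ[ℝ] EuclideanSpace ℝ (Fin 3)) = 1 →
      ∀ x : EuclideanSpace ℝ (Fin 3), h (g x) = g (h x) ∧ P (g x) = P x) ∧
  (∀ s : Set (EuclideanSpace ℝ (Fin 3)), IsOpen s → s.Nonempty → ∃ x ∈ s, x ≠ 0 ∧ h x ≠ 0)

/-- Conjuncts 12–18 of the crux: `(Q, Φ)` RESOLVES the cone `h` at order `a` — a `C^∞` steady Euler flow on `ℝ³`,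
chiral-octahedrally equivariant, nonzero somewhere in every nonempty open set, whose tangent flow at infinity is `h`:
`‖Q y − h y‖ + ‖y‖·‖DQ y − Dh y‖ ≤ C‖y‖^(−a−δ)` for `‖y‖ ≥ 1`, some `C` and some `δ > 0`. -/
def IsResolution (a : ℝ) (h Q : EuclideanSpace ℝ (Fin 3) → EuclideanSpace ℝ (Fin 3))
    (Φ : EuclideanSpace ℝ (Fin 3) → ℝ) : Prop :=
  ContDiff ℝ (⊤ : ℕ∞) Q ∧ ContDiff ℝ (⊤ : ℕ∞) Φ ∧ Literature.Analysis.FluidPDE.VectorCalculus.IsDivFree Q ∧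
  (∀ y : EuclideanSpace ℝ (Fin 3), Literature.Analysis.FluidPDE.convect Q Q y + gradient Φ y = 0) ∧
  (∀ g : EuclideanSpace ℝ (Fin 3) ≃ₗᵢ[ℝ] EuclideanSpace ℝ (Fin 3), Literature.Analysis.FluidPDE.IsOctahedralIsometry g →
    LinearMap.det (g.toLinearEquiv : EuclideanSpace ℝ (Fin 3) →ₗ[ℝ] EuclideanSpace ℝ (Fin 3)) = 1 →
      ∀ y : EuclideanSpace ℝ (Fin 3), Q (g y) = g (Q y) ∧ Φ (g y) = Φ y) ∧
  (∀ s : Set (EuclideanSpace ℝ (Fin 3)), IsOpen s → s.Nonempty → ∃ y ∈ s, Q y ≠ 0) ∧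
  (∃ C δ : ℝ, 0 < δ ∧ ∀ y : EuclideanSpace ℝ (Fin 3), 1 ≤ ‖y‖ →
    ‖Q y - h y‖ + ‖y‖ * ‖fderiv ℝ Q y - fderiv ℝ h y‖ ≤ C * ‖y‖ ^ (-a - δ))

/-- Conjuncts 19–23 of the crux: `(b, W, q)` is a first-order COLLAPSE CORRECTOR of `Q` at order `a` — `b < 0`,
`W, q` smooth, `div W = 0`, and `(Q·∇)W + (W·∇)Q + ∇q = ΔQ + b (aQ + (y·∇)Q)` on `ℝ³` (equation (★★) of the route,
with `b = λλ̇/ν` the collapse clock). -/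
def IsCollapseCorrector (a : ℝ) (Q : EuclideanSpace ℝ (Fin 3) → EuclideanSpace ℝ (Fin 3)) (b : ℝ)
    (W : EuclideanSpace ℝ (Fin 3) → EuclideanSpace ℝ (Fin 3)) (q : EuclideanSpace ℝ (Fin 3) → ℝ) : Prop :=
  b < 0 ∧ ContDiff ℝ (⊤ : ℕ∞) W ∧ ContDiff ℝ (⊤ : ℕ∞) q ∧ Literature.Analysis.FluidPDE.VectorCalculus.IsDivFree W ∧
  (∀ y : EuclideanSpace ℝ (Fin 3), Literature.Analysis.FluidPDE.convect Q W y + Literature.Analysis.FluidPDE.convect W Q y +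
    gradient q y = Laplacian.laplacian Q y + b • (a • Q y + (fderiv ℝ Q y) y))

/-- Statement of stub 2 (`stub_desing`, "ResolveOnly" of the route header): every admissible cone is resolved —
it is the tangent flow at infinity of an O-equivariant smooth steady Euler flow on `ℝ³` with conical tail. -/
def ResolveOnly : Prop :=
  ∀ (a l₀ : ℝ) (h : EuclideanSpace ℝ (Fin 3) → EuclideanSpace ℝ (Fin 3)) (P : EuclideanSpace ℝ (Fin 3) → ℝ),
    IsAdmissibleCone a l₀ h P →
      ∃ (Q : EuclideanSpace ℝ (Fin 3) → EuclideanSpace ℝ (Fin 3)) (Φ : EuclideanSpace ℝ (Fin 3) → ℝ), IsResolution a h Q Φ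

/-- Statement of stub 3 (`stub_corrector`, "CorrectOnly" of the route header): every resolved skeleton admits a
first-order collapse corrector with `b < 0`. -/
def CorrectOnly : Prop :=
  ∀ (a l₀ : ℝ) (h : EuclideanSpace ℝ (Fin 3) → EuclideanSpace ℝ (Fin 3)) (P : EuclideanSpace ℝ (Fin 3) → ℝ)
    (Q : EuclideanSpace ℝ (Fin 3) → EuclideanSpace ℝ (Fin 3)) (Φ : EuclideanSpace ℝ (Fin 3) → ℝ),
    IsAdmissibleCone a l₀ h P → IsResolution a h Q Φ →
      ∃ (b : ℝ) (W : EuclideanSpace ℝ (Fin 3) → EuclideanSpace ℝ (Fin 3)) (q : EuclideanSpace ℝ (Fin 3) → ℝ),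
        IsCollapseCorrector a Q b W q

/-! ### The regrouping is verbatim (sorry-free certificates) -/

/-- The route's crux #3 is, definitionally, "some admissible cone exists". -/
theorem interactingLogPeriodicCone_iff :
    InteractingLogPeriodicCone ↔
      ∃ (a l₀ : ℝ) (h : EuclideanSpace ℝ (Fin 3) → EuclideanSpace ℝ (Fin 3)) (P : EuclideanSpace ℝ (Fin 3) → ℝ),
        IsAdmissibleCone a l₀ h P :=
  Iff.rfl

/-- The crux is exactly "some admissible cone has a resolution that has a collapse corrector" (its 23 conjuncts,
regrouped 11 + 7 + 5; pure re-association). -/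
theorem collapsingResolver_iff :
    CollapsingResolver ↔
      ∃ (a l₀ : ℝ) (h : EuclideanSpace ℝ (Fin 3) → EuclideanSpace ℝ (Fin 3)) (P : EuclideanSpace ℝ (Fin 3) → ℝ)
        (Q : EuclideanSpace ℝ (Fin 3) → EuclideanSpace ℝ (Fin 3)) (Φ : EuclideanSpace ℝ (Fin 3) → ℝ) (b : ℝ)
        (W : EuclideanSpace ℝ (Fin 3) → EuclideanSpace ℝ (Fin 3)) (q : EuclideanSpace ℝ (Fin 3) → ℝ),
        IsAdmissibleCone a l₀ h P ∧ IsResolution a h Q Φ ∧ IsCollapseCorrector a Q b W q := by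
  constructor
  · rintro ⟨a, l₀, h, P, Q, Φ, b, W, q, c1, c2, c3, c4, c5, c6, c7, c8, c9, c10, c11, c12, c13, c14, c15, c16, c17,
      c18, c19, c20, c21, c22, c23⟩
    exact ⟨a, l₀, h, P, Q, Φ, b, W, q, ⟨c1, c2, c3, c4, c5, c6, c7, c8, c9, c10, c11⟩,
      ⟨c12, c13, c14, c15, c16, c17, c18⟩, ⟨c19, c20, c21, c22, c23⟩⟩
  · rintro ⟨a, l₀, h, P, Q, Φ, b, W, q, ⟨c1, c2, c3, c4, c5, c6, c7, c8, c9, c10, c11⟩,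
      ⟨c12, c13, c14, c15, c16, c17, c18⟩, ⟨c19, c20, c21, c22, c23⟩⟩
    exact ⟨a, l₀, h, P, Q, Φ, b, W, q, c1, c2, c3, c4, c5, c6, c7, c8, c9, c10, c11, c12, c13, c14, c15, c16, c17,
      c18, c19, c20, c21, c22, c23⟩

/-- Bridge to the landed Literature definition (the route's DEFINITION REQUEST, now
`Literature.Analysis.FluidPDE.IsLogPeriodicSteadyEulerCone`, with its API: `.conj` isometry covariance, `.zpow`
discrete dilation group, homogeneous ⇒ log-periodic): an admissible cone is a log-periodic steady Euler cone in
the window `1 < a < 3/2`, `1 < l₀`, that is chiral-octahedrally equivariant and interacting. Sorry-free; for the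
stub workers of `stub_cone` / `stub_desing`. -/
theorem isAdmissibleCone_iff {a l₀ : ℝ} {h : EuclideanSpace ℝ (Fin 3) → EuclideanSpace ℝ (Fin 3)}
    {P : EuclideanSpace ℝ (Fin 3) → ℝ} :
    IsAdmissibleCone a l₀ h P ↔
      1 < a ∧ a < 3 / 2 ∧ 1 < l₀ ∧ Literature.Analysis.FluidPDE.IsLogPeriodicSteadyEulerCone a l₀ h P ∧
      (∀ g : EuclideanSpace ℝ (Fin 3) ≃ₗᵢ[ℝ] EuclideanSpace ℝ (Fin 3),
        Literature.Analysis.FluidPDE.IsOctahedralIsometry g →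
          LinearMap.det (g.toLinearEquiv : EuclideanSpace ℝ (Fin 3) →ₗ[ℝ] EuclideanSpace ℝ (Fin 3)) = 1 →
            ∀ x : EuclideanSpace ℝ (Fin 3), h (g x) = g (h x) ∧ P (g x) = P x) ∧
      (∀ s : Set (EuclideanSpace ℝ (Fin 3)), IsOpen s → s.Nonempty → ∃ x ∈ s, x ≠ 0 ∧ h x ≠ 0) := by
  rw [Literature.Analysis.FluidPDE.isLogPeriodicSteadyEulerCone_iff]
  constructor
  · rintro ⟨c1, c2, c3, c4, c5, c6, c7, c8, c9, c10, c11⟩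
    exact ⟨c1, c2, c3, ⟨c4, c5, c6, c7, c8, c9⟩, c10, c11⟩
  · rintro ⟨c1, c2, c3, ⟨c4, c5, c6, c7, c8, c9⟩, c10, c11⟩
    exact ⟨c1, c2, c3, c4, c5, c6, c7, c8, c9, c10, c11⟩

/-! ### The three registered stubs -/

/-- **stub 1 — `stub_cone` (XL, OPEN; twin by name of route item `stmt-NavierStokesRegularity-19062`,
`ConeTipCollapse.InteractingLogPeriodicCone`, crux rank 3, "the wall"):** there exist `1 < a < 3/2`, `l₀ > 1` and an
interacting, chiral-octahedrally equivariant, `l₀`-discretely self-similar `C¹` steady Euler cone `(h,P)` on `ℝ³ ∖ 0`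
(equivalently a nontrivial O-equivariant `C¹` solution of the reduced first-order system on `S² × (ℝ/(log l₀)ℤ)`).
Why it might fail (filed): Shvydkoy conjectures no nontrivial `C¹` homogeneous solutions for `α > −1`
(arXiv:1510.03378 p.4) and proves none axisymmetric for `0 < α < 2` (Prop 5.1); log-periodicity only removes the
Poincaré–Hopf forcing. -/
theorem stub_cone : InteractingLogPeriodicCone := by
  sorry

/-- **stub 2 — `stub_desing` (XL, OPEN; ∀-form "ResolveOnly"):** every admissible cone `(a,l₀,h,P)` is the tangent
flow at infinity of some resolution `(Q,Φ)` — a `C^∞` O-equivariant steady Euler flow on `ℝ³`, nonzero on every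
nonempty open set, with `‖Q − h‖ + ‖y‖‖DQ − Dh‖ ≤ C‖y‖^(−a−δ)` for `‖y‖ ≥ 1`. Intended engine: equivariant
desingularisation of the cone tip by Voigt–MHD magnetic relaxation from the truncated cone (arXiv:2208.11109
Thms 1.1–1.2), upgraded to `C^∞`. Why it might fail: anti-Grad — a smooth NON-symmetric steady Euler flow with a
region of compact invariant tori may not exist at all (arXiv:2007.09103 Conj. 1; arXiv:2305.05987 p.12), and
relaxation may only reach non-smooth (`H¹`/`W^{k,p}`) limits. Immune to cheap refutation: any counterexample is an
admissible cone, i.e. a proof of `stub_cone`. -/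
theorem stub_desing : ResolveOnly := by
  sorry

/-- **stub 3 — `stub_corrector` (L/XL, OPEN; ∀-form "CorrectOnly"):** every resolved skeleton `(a,l₀,h,P,Q,Φ)`
admits a first-order collapse corrector `(b,W,q)` with `b < 0`: `(Q·∇)W + (W·∇)Q + ∇q = ΔQ + b(aQ + (y·∇)Q)`,
`div W = 0`, `W, q ∈ C^∞`. Intended engine: Fredholm solvability of the linearised steady Euler operator at `Q`
(cokernel `f(B_Q)Q`, `g(B_Q) curl Q` on the compact Bernoulli tori, Arnold's structure theorem; hyperbolic axis
chains), the per-torus energy/flux laws fixing the sign of `b`. Why it might fail: the per-torus laws may force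
`b > 0` (the 2-D shadow is the Oseen vortex, `b > 0`) — the route's CHEAPEST FALSIFIER; not an instance of the
refuted compact-eddy corrector `AdiabaticEddy.CorrectorSolvable` (stmt-1429) because `Q` vanishes on no open set. -/
theorem stub_corrector : CorrectOnly := by
  sorry

/-! ### Birth composition (the skeleton theorem) -/

/-- **The skeleton theorem.** The crux BY NAME from the three registered stubs, used by name: take the cone of
`stub_cone`, resolve it by `stub_desing`, correct the resolution by `stub_corrector`, and re-associate the 23
conjuncts (`collapsingResolver_iff`). -/
theorem CollapsingResolver_of : CollapsingResolver := by
  obtain ⟨a, l₀, h, P, hc⟩ := interactingLogPeriodicCone_iff.mp stub_cone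
  obtain ⟨Q, Φ, hr⟩ := stub_desing a l₀ h P hc
  obtain ⟨b, W, q, hk⟩ := stub_corrector a l₀ h P Q Φ hc hr
  exact collapsingResolver_iff.mpr ⟨a, l₀, h, P, Q, Φ, b, W, q, hc, hr, hk⟩

end Summit.NavierStokesRegularity.NavierStokesRegularity.Cruxes.CollapsingResolver.Birth
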